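import Mathlib
import HarnessLib

/-!
# Separated blocks and read sets: regrouping a sum of local terms by blocks, and the dependence sets of the block sums

HONEST FRAMING: exact (Metropolis-corrected) sampling algorithms for lattice gauge theory;
figures of merit are autocorrelation/cost numbers at stated couplings and volumes; no
continuum-physics claim.

Venture `LatticeQCDFlow` (cell pub-lqcd), topic `Exactness`; FANOUT row 7 (`s0-cpn-null`: the
S0-D1 rung — 2D CP⁹, Lüscher's LO trivializing map inside HMC, Engel–Schaefer 2011).  NEW WORK of
the cell over Mathlib only (finite combinatorics of `Finset`s and Mathlib's `DependsOn`); nothing is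
cited as a fact.  This is the bookkeeping half of the block tensorization floor
(`Exactness/LatticeBlockEntropyFloor.lean`): a log-weight that is a SUM OF LOCAL TERMS `Σ_a g_a`, the
term `g_a` reading only the coordinates in its read set `R_a`, is regrouped along a family of blocks
`B_j` that are SEPARATED for the read sets (no read set meets two blocks) into block sums `h_j` (the
terms whose read set meets `B_j`) and a free remainder `r` (the terms meeting no block); `h_j` then
reads only `B_j ∪ C` and `r` only `C`, where `C` is the complement of the blocks — exactly the shape
`LatticeBlockEntropyFloor.sum_blocks_sub_le_integral_add_log_integral_exp_neg` consumes.  Used by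
`Exactness/SphereLOFlowEntropyFloor.lean`.

## Content

* `pairwiseDisjoint_filter_meets` — under separation, the classes "read set meets `B_j`" are
  pairwise disjoint; `mem_biUnion_filter_meets_or_free` — every index meets some block or none.
* **`sum_eq_sum_blocks_add_sum_free`** — `Σ_a g_a = Σ_{j∈T} Σ_{a : R_a ∩ B_j ≠ ∅} g_a + Σ_{a free} g_a`.
* **`readSet_subset_block_union_compl`** — if `R_a` meets `B_j` then `R_a ⊆ B_j ∪ (univ ∖ ⋃_T B)`;
  `readSet_subset_compl_of_free`.
* `dependsOn_finset_sum` — a sum of terms depending on `R_a` depends on `⋃ R_a`;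
  **`dependsOn_blockSum`** (`h_j` depends on `B_j ∪ C`), **`dependsOn_freeSum`** (`r` depends on `C`).

NOT CLAIMED: anything measure-theoretic (see `LatticeBlockEntropyFloor`).
-/

namespace Summit.Ventures.LatticeQCDFlow.Exactness

open Function Set
open scoped Classical

variable {α : Type*} [Fintype α] {J : Type*} {ι : Type*}

/-! ## §1 The partition of the index set induced by separated blocks -/

section Partition

variable (R : α → Set ι) (T : Finset J) (B : J → Finset ι)

/-- **Separation ⇒ the classes "meets `B_j`" are pairwise disjoint** (as `j` ranges over `T`). -/
theorem pairwiseDisjoint_filter_meets [DecidableEq α]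
    (hsep : ∀ a, ∀ j ∈ T, ∀ j' ∈ T, ¬ Disjoint (R a) ↑(B j) → ¬ Disjoint (R a) ↑(B j') → j = j') :
    (↑T : Set J).PairwiseDisjoint
      (fun j => (Finset.univ.filter fun a => ¬ Disjoint (R a) ↑(B j))) := by
  intro j hj j' hj' hne
  rw [Function.onFun, Finset.disjoint_left]
  intro a ha ha'
  rw [Finset.mem_filter] at ha ha'
  exact hne (hsep a j hj j' hj' ha.2 ha'.2)

/-- Every index either meets some block of `T` or is free (meets none). -/
theorem mem_biUnion_filter_meets_or_free [DecidableEq α] (a : α) :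
    a ∈ T.biUnion (fun j => Finset.univ.filter fun a => ¬ Disjoint (R a) ↑(B j)) ∨
      a ∈ Finset.univ.filter fun a => ∀ j ∈ T, Disjoint (R a) ↑(B j) := by
  by_cases h : ∃ j ∈ T, ¬ Disjoint (R a) ↑(B j)
  · obtain ⟨j, hj, hja⟩ := h
    exact Or.inl (Finset.mem_biUnion.2 ⟨j, hj, Finset.mem_filter.2 ⟨Finset.mem_univ _, hja⟩⟩)
  · push Not at h
    exact Or.inr (Finset.mem_filter.2 ⟨Finset.mem_univ _, h⟩)

/-- **REGROUPING A SUM OF LOCAL TERMS BY SEPARATED BLOCKS**: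
`Σ_a g_a = Σ_{j∈T} Σ_{a : R_a meets B_j} g_a + Σ_{a : R_a meets no block} g_a`. -/
theorem sum_eq_sum_blocks_add_sum_free [DecidableEq α] {M : Type*} [AddCommMonoid M]
    (hsep : ∀ a, ∀ j ∈ T, ∀ j' ∈ T, ¬ Disjoint (R a) ↑(B j) → ¬ Disjoint (R a) ↑(B j') → j = j')
    (g : α → M) :
    ∑ a, g a = ∑ j ∈ T, ∑ a ∈ Finset.univ.filter (fun a => ¬ Disjoint (R a) ↑(B j)), g a +
      ∑ a ∈ Finset.univ.filter (fun a => ∀ j ∈ T, Disjoint (R a) ↑(B j)), g a := by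
  have hcover : (Finset.univ : Finset α) =
      T.biUnion (fun j => Finset.univ.filter fun a => ¬ Disjoint (R a) ↑(B j)) ∪
        Finset.univ.filter fun a => ∀ j ∈ T, Disjoint (R a) ↑(B j) := by
    ext a
    simp only [Finset.mem_univ, Finset.mem_union, true_iff]
    exact mem_biUnion_filter_meets_or_free R T B a
  have hdisj : Disjoint (T.biUnion (fun j => Finset.univ.filter fun a => ¬ Disjoint (R a) ↑(B j)))
      (Finset.univ.filter fun a => ∀ j ∈ T, Disjoint (R a) ↑(B j)) := by
    rw [Finset.disjoint_left]
    intro a ha hfree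
    obtain ⟨j, hj, hja⟩ := Finset.mem_biUnion.1 ha
    exact (Finset.mem_filter.1 hja).2 ((Finset.mem_filter.1 hfree).2 j hj)
  conv_lhs => rw [hcover]
  rw [Finset.sum_union hdisj, Finset.sum_biUnion (pairwiseDisjoint_filter_meets R T B hsep)]

end Partition

/-! ## §2 Read sets versus blocks and corridors -/

section ReadSets

variable [Fintype ι] [DecidableEq ι] (R : α → Set ι) (T : Finset J) (B : J → Finset ι)

omit [Fintype α] in
/-- **If the read set of `a` meets the block `B_j`, it lies in `B_j ∪ C`**, `C = univ ∖ ⋃_{T} B` the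
complement of the blocks (separation: it meets no other block). -/
theorem readSet_subset_block_union_compl
    (hsep : ∀ a, ∀ j ∈ T, ∀ j' ∈ T, ¬ Disjoint (R a) ↑(B j) → ¬ Disjoint (R a) ↑(B j') → j = j')
    {a : α} {j : J} (hj : j ∈ T) (hja : ¬ Disjoint (R a) ↑(B j)) :
    R a ⊆ ↑(B j) ∪ ↑(Finset.univ \ T.biUnion B) := by
  intro i hi
  by_cases hiU : i ∈ T.biUnion B
  · obtain ⟨j', hj', hij'⟩ := Finset.mem_biUnion.1 hiU
    have hmeet : ¬ Disjoint (R a) ↑(B j') :=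
      Set.not_disjoint_iff.2 ⟨i, hi, Finset.mem_coe.2 hij'⟩
    have hjj' : j = j' := hsep a j hj j' hj' hja hmeet
    subst hjj'
    exact Or.inl (Finset.mem_coe.2 hij')
  · exact Or.inr (Finset.mem_coe.2 (Finset.mem_sdiff.2 ⟨Finset.mem_univ _, hiU⟩))

omit [Fintype α] in
/-- **A free read set lies in the corridors**: `(∀ j ∈ T, R_a ∩ B_j = ∅) ⇒ R_a ⊆ univ ∖ ⋃_T B`. -/
theorem readSet_subset_compl_of_free {a : α} (hfree : ∀ j ∈ T, Disjoint (R a) ↑(B j)) :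
    R a ⊆ ↑(Finset.univ \ T.biUnion B) := by
  intro i hi
  refine Finset.mem_coe.2 (Finset.mem_sdiff.2 ⟨Finset.mem_univ _, fun hiU => ?_⟩)
  obtain ⟨j, hj, hij⟩ := Finset.mem_biUnion.1 hiU
  exact Set.disjoint_left.1 (hfree j hj) hi (Finset.mem_coe.2 hij)

end ReadSets

/-! ## §3 Dependence sets of the block sums -/

section Depends

variable {X : Type*} {M : Type*} [AddCommMonoid M]

omit [Fintype α] in
/-- A finite sum of terms depending on `R_a` depends only on `⋃_{a∈s} R_a`. -/
theorem dependsOn_finset_sum (s : Finset α) (R : α → Set ι) {g : α → (ι → X) → M}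
    (hg : ∀ a ∈ s, DependsOn (g a) (R a)) :
    DependsOn (fun ω => ∑ a ∈ s, g a ω) (⋃ a ∈ s, R a) := by
  intro ω₁ ω₂ h
  exact Finset.sum_congr rfl fun a ha => hg a ha fun i hi => h i (mem_biUnion ha hi)

variable [Fintype ι] [DecidableEq ι] (R : α → Set ι) (T : Finset J) (B : J → Finset ι)

/-- **THE BLOCK SUM `h_j = Σ_{a : R_a meets B_j} g_a` DEPENDS ONLY ON `B_j ∪ C`** (`C` the complement of
the blocks), under separation. -/
theorem dependsOn_blockSum
    (hsep : ∀ a, ∀ j ∈ T, ∀ j' ∈ T, ¬ Disjoint (R a) ↑(B j) → ¬ Disjoint (R a) ↑(B j') → j = j')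
    {g : α → (ι → X) → M} (hg : ∀ a, DependsOn (g a) (R a)) {j : J} (hj : j ∈ T) :
    DependsOn (fun ω => ∑ a ∈ Finset.univ.filter (fun a => ¬ Disjoint (R a) ↑(B j)), g a ω)
      (↑(B j) ∪ ↑(Finset.univ \ T.biUnion B)) := by
  refine DependsOn.mono ?_ (dependsOn_finset_sum _ R fun a _ => hg a)
  intro i hi
  obtain ⟨a, ha, hia⟩ := mem_iUnion₂.1 hi
  exact readSet_subset_block_union_compl R T B hsep hj (Finset.mem_filter.1 ha).2 hia

/-- **THE FREE REMAINDER `r = Σ_{a free} g_a` DEPENDS ONLY ON THE CORRIDORS `C`.** -/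
theorem dependsOn_freeSum {g : α → (ι → X) → M} (hg : ∀ a, DependsOn (g a) (R a)) :
    DependsOn (fun ω => ∑ a ∈ Finset.univ.filter (fun a => ∀ j ∈ T, Disjoint (R a) ↑(B j)), g a ω)
      ↑(Finset.univ \ T.biUnion B) := by
  refine DependsOn.mono ?_ (dependsOn_finset_sum _ R fun a _ => hg a)
  intro i hi
  obtain ⟨a, ha, hia⟩ := mem_iUnion₂.1 hi
  exact readSet_subset_compl_of_free R T B (Finset.mem_filter.1 ha).2 hia

end Depends

end Summit.Ventures.LatticeQCDFlow.Exactness
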